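import Mathlib
import Summits.Ventures.PercRepro2.SwOutMixedArmsClosure

/-!
# The several-arms big-block lemma under the geometric closure, on a slice (blind cell PercRepro2,
night-4 g21, 2026-08-27; proofs/NIGHT4-G21.md §2)

Fix the far arms `f₀`.  On the slice `f = f₀` of the non-leaking block of a set `Q` closed under
`ArmLower` and `RaiseUP` (pure arms), the rigid inequality holds with the `f`-FROZEN blue set
`EBT ∅` (the red set of the flip that keeps the far arms): `slice_card_le`.  The proof:
(a) the OFF-DIAGONAL T-slab points `(⊤, A, B, f₀)`, `A ≠ B`, inject into the B-slab points with
`e ≠ ⊥` by `phiOff`, which carries `ER` to `EBT ∅`; (b) the points with a red u-arm and `uP = e`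
(the diagonal of the T-slab and the whole mixed part) sit in the cube `Config (ι ⊕ ρ)` via
`(s, C) ↦ (s, a0, C, C, f₀)`: the down-closure `Mt` of their cube projections is a LOWER SET whose
points with a blue u-arm are realised in `Q` (`realize`: the diagonal point at a mixed `s`, the
point `(⊥, C, ⊥, f₀)` at `s = ⊥`), and the cube principle (`LocRows.card_inter_le_of_cube`,
Harris twice and the flip) bounds their count by the count of mixed points and B-slab points with
`e = ⊥`; (c) the two target families are disjoint.  The slice where `ER (⊥, ⊥, ⊥, f₀) ∈ 𝓔` is
trivial (every point of the slice counts on both sides).  Counting is done with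
`N P = #{x : P x}` (SwOutMixedArmsCount).
-/

namespace Summit.Ventures.PercRepro2

namespace MixedArms

open scoped Classical

variable {ι ρ ν κ : Type*}

section NHelpers

variable {X Y Z : Type*} [Fintype X]

/-- A count is at most another count when an injection carries the first predicate into the
second. -/
lemma N_le_of_inj [Fintype Y] {P : X → Prop} {P' : Y → Prop} (φ : X → Y)
    (hφ : ∀ x, P x → P' (φ x)) (hinj : ∀ x y, P x → P y → φ x = φ y → x = y) : N P ≤ N P' := by
  unfold N
  refine Finset.card_le_card_of_injOn φ (fun x hx => ?_) (fun x hx y hy hxy => ?_)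
  · rw [Finset.mem_coe, Finset.mem_filter] at hx
    rw [Finset.mem_coe, Finset.mem_filter]
    exact ⟨Finset.mem_univ _, hφ x hx.2⟩
  · rw [Finset.mem_coe, Finset.mem_filter] at hx hy
    exact hinj x y hx.2 hy.2 hxy

/-- A count is the sum of its fibre counts. -/
lemma N_eq_sum_fiber [Fintype Y] (g : X → Y) (P : X → Prop) :
    N P = ∑ b, N (fun x => P x ∧ g x = b) := by
  unfold N
  rw [Finset.card_eq_sum_card_fiberwise (f := g) (t := Finset.univ)
    (fun _ _ => Finset.mem_univ _)]
  apply Finset.sum_congr rfl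
  intro b _
  congr 1
  ext x
  simp only [Finset.mem_filter, Finset.mem_univ, true_and]

/-- The count of a fibre, transported along a parametrisation of the fibre. -/
lemma N_fiber_eq [Fintype Z] (g : X → Y) (h : Y → Z → X) (π : X → Z)
    (hgh : ∀ y z, g (h y z) = y) (hπh : ∀ y z, π (h y z) = z) (hhπ : ∀ x, h (g x) (π x) = x)
    (P : X → Prop) (b : Y) : N (fun x => P x ∧ g x = b) = N (fun z => P (h b z)) := by
  apply le_antisymm
  · refine N_le_of_inj π (fun x hx => ?_) (fun x y hx hy hxy => ?_)
    · obtain ⟨hx, rfl⟩ := hx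
      rw [hhπ]
      exact hx
    · rw [← hhπ x, ← hhπ y, hx.2, hy.2, hxy]
  · refine N_le_of_inj (h b) (fun z hz => ⟨hz, hgh b z⟩) (fun z z' _ _ hzz' => ?_)
    rw [← hπh b z, ← hπh b z', hzz']

end NHelpers

section CubeVocab

variable [IsEmpty ν] {arm : ν → ρ}

/-- The cube point `(s, C)`. -/
def cubePt (s : Config ι) (C : ρ → Bool) : Config (ι ⊕ ρ) := Sum.elim s C

/-- The u-arm coordinates of a cube point. -/
def xs (x : Config (ι ⊕ ρ)) : Config ι := fun j => x (Sum.inl j)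

/-- The arm coordinates of a cube point. -/
def xC (x : Config (ι ⊕ ρ)) : ρ → Bool := fun r => x (Sum.inr r)

/-- The diagonal realisation of a cube point on the slice `f₀`: `(s, C, C, f₀)`. -/
def toPt (f₀ : Config κ) (x : Config (ι ⊕ ρ)) : PtR ι ρ ν κ := (xs x, a0, xC x, xC x, f₀)

/-- The bottom realisation of a cube point on the slice `f₀`: `(⊥, C, ⊥, f₀)`. -/
def botPt (f₀ : Config κ) (x : Config (ι ⊕ ρ)) : PtR ι ρ ν κ :=
  ((fun _ => false), a0, xC x, (fun _ => false), f₀)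

/-- The bottom point of a slice: `(⊥, ⊥, ⊥, f)`. -/
def botF (f : Config κ) : PtR ι ρ ν κ := ((fun _ => false), a0, (fun _ => false), (fun _ => false), f)

/-- The cube projection of a point: `(s, uP)`. -/
def projCube (q : PtR ι ρ ν κ) : Config (ι ⊕ ρ) := cubePt q.1 q.2.2.1

omit [IsEmpty ν] in
/-- A cube point is determined by its two projections. -/
lemma cubePt_xs_xC (x : Config (ι ⊕ ρ)) : cubePt (xs x) (xC x) = x := by
  funext k
  cases k <;> rfl

/-- The cube projection of the diagonal realisation is the point. -/
lemma projCube_toPt (f₀ : Config κ) (x : Config (ι ⊕ ρ)) :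
    projCube (toPt f₀ x : PtR ι ρ ν κ) = x := cubePt_xs_xC x

/-- The cube projection of the bottom realisation is the point when its u-arms are blue. -/
lemma projCube_botPt (f₀ : Config κ) {x : Config (ι ⊕ ρ)} (hx : ∀ j, xs x j = false) :
    projCube (botPt f₀ x : PtR ι ρ ν κ) = x := by
  funext k
  cases k with
  | inl j => exact (hx j).symm
  | inr r => rfl

/-- The diagonal realisation of the cube projection of a point with `uP = e` on the slice is the
point. -/
lemma toPt_projCube {f₀ : Config κ} {q : PtR ι ρ ν κ} (hq : q.2.2.1 = q.2.2.2.1)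
    (hf : q.2.2.2.2 = f₀) : toPt f₀ (projCube q) = q := by
  obtain ⟨s, a, uP, e, f⟩ := q
  simp only at hq hf
  subst hq hf
  rw [config_eq_a0 a]
  rfl

/-- The diagonal realisation is monotone. -/
lemma toPt_mono (f₀ : Config κ) {x y : Config (ι ⊕ ρ)} (h : x ≤ y) :
    (toPt f₀ x : PtR ι ρ ν κ) ≤ toPt f₀ y :=
  ⟨fun _ => h _, le_rfl, fun _ => h _, fun _ => h _, le_rfl⟩

/-- The `f`-frozen flip of the diagonal realisation is the diagonal realisation of the flipped
cube point. -/
lemma flipT_empty_toPt [DecidableEq κ] (f₀ : Config κ) (x : Config (ι ⊕ ρ)) :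
    flipT ∅ (toPt f₀ x : PtR ι ρ ν κ) = toPt f₀ (flipAll x) := by
  simp only [flipT, toPt, Prod.mk.injEq]
  refine ⟨rfl, Subsingleton.elim _ _, rfl, rfl, ?_⟩
  funext k
  simp only [Finset.notMem_empty, if_false]

/-- The `f`-frozen blue set of the diagonal realisation. -/
lemma EBT_toPt [DecidableEq κ] (f₀ : Config κ) (x : Config (ι ⊕ ρ)) :
    EBT ∅ (toPt f₀ x : PtR ι ρ ν κ) = ER (toPt f₀ (flipAll x) : PtR ι ρ ν κ) := by
  unfold EBT
  rw [flipT_empty_toPt]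

/-- The `f`-frozen blue set of the bottom realisation at blue u-arms. -/
lemma EBT_botPt [DecidableEq κ] (f₀ : Config κ) {x : Config (ι ⊕ ρ)} (hx : ∀ j, xs x j = false) :
    EBT ∅ (botPt f₀ x : PtR ι ρ ν κ) = ER (toPt f₀ (flipAll x) : PtR ι ρ ν κ) := by
  unfold EBT
  apply ER_eq_of_eq
  · funext j
    simp only [flipT, botPt, toPt, flipAll, xs, Bool.not_false]
    rw [show x (Sum.inl j) = false from hx j]
    rfl
  · exact Subsingleton.elim _ _
  · rfl
  · funext k
    simp only [flipT, botPt, toPt, Finset.notMem_empty, if_false]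

/-- Without a red u-arm, the red set is that of the bottom point of the slice. -/
lemma ER_eq_botF_of_not_red {q : PtR ι ρ ν κ} (h : ¬ ∃ j, q.1 j = true) :
    ER q = ER (botF q.2.2.2.2 : PtR ι ρ ν κ) := by
  ext x
  rcases x with j | ⟨⟨⟩⟩ | i | r | k
  · rw [mem_ER_inl, mem_ER_inl]
    exact ⟨fun hj => absurd ⟨j, hj⟩ h, fun hj => absurd hj Bool.false_ne_true⟩
  · rw [mem_ER_u, mem_ER_u]
    exact ⟨fun hj => absurd hj h, fun ⟨j, hj⟩ => absurd hj Bool.false_ne_true⟩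
  · exact isEmptyElim i
  · rw [mem_ER_p, mem_ER_p]
    refine ⟨fun hj => absurd hj.1 h, fun h' => ?_⟩
    obtain ⟨⟨j, hj⟩, -⟩ := h'
    exact absurd hj Bool.false_ne_true
  · exact Iff.rfl

/-- The bottom point of the slice lies below every point of the slice. -/
lemma botF_le (q : PtR ι ρ ν κ) : (botF q.2.2.2.2 : PtR ι ρ ν κ) ≤ q :=
  ⟨fun _ => Bool.false_le _, le_of_eq (config_eq_a0 _).symm, fun _ => Bool.false_le _,
    fun _ => Bool.false_le _, le_rfl⟩

/-- The red set contains the red set of the bottom point of its slice. -/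
lemma ER_botF_subset (q : PtR ι ρ ν κ) : ER (botF q.2.2.2.2 : PtR ι ρ ν κ) ⊆ ER q :=
  ER_mono (botF_le q)

/-- The `f`-frozen blue set contains the red set of the bottom point of its slice. -/
lemma ER_botF_subset_EBT [DecidableEq κ] (q : PtR ι ρ ν κ) :
    ER (botF q.2.2.2.2 : PtR ι ρ ν κ) ⊆ EBT ∅ q := by
  unfold EBT
  have h : (flipT ∅ q).2.2.2.2 = q.2.2.2.2 := by
    funext k
    simp only [flipT, Finset.notMem_empty, if_false]
  rw [← h]
  exact ER_mono (botF_le _)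

end CubeVocab

section LowerSet

variable [IsEmpty ν] [Nonempty ι] {arm : ν → ρ} {Q : Set (PtR ι ρ ν κ)}

/-- The down-closure in the cube of the points of `Q` on the slice with a red u-arm. -/
def Mt (Q : Set (PtR ι ρ ν κ)) (arm : ν → ρ) (f₀ : Config κ) : Set (Config (ι ⊕ ρ)) :=
  {x | ∃ q, q ∈ Q ∧ ¬ Leak q arm ∧ (∃ j, q.1 j = true) ∧ q.2.2.2.2 = f₀ ∧ x ≤ projCube q}

omit [IsEmpty ν] [Nonempty ι] in
/-- The down-closure is a lower set. -/
lemma isLowerSet_Mt (f₀ : Config κ) : IsLowerSet (Mt Q arm f₀) := by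
  rintro x y hle ⟨q, hq, hL, hs, hf, hxq⟩
  exact ⟨q, hq, hL, hs, hf, le_trans hle hxq⟩

omit [Nonempty ι] in
/-- A cube point of the down-closure with a blue u-arm is realised in `Q` by its diagonal point. -/
lemma toPt_mem_of_Mt (hL : ArmLower arm Q) {f₀ : Config κ} {x : Config (ι ⊕ ρ)}
    (hx : x ∈ Mt Q arm f₀) (hs' : ∃ j, xs x j = false) : (toPt f₀ x : PtR ι ρ ν κ) ∈ Q := by
  obtain ⟨q, hq, hqL, hs, hf, hxq⟩ := hx
  have h := mem_diag_of_red hL hq hqL hs (s := xs x) (C := xC x) (f := f₀)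
    (fun j => hxq (Sum.inl j)) (fun r => hxq (Sum.inr r)) (le_of_eq hf.symm) hs'
  have e : (xs x, q.2.1, xC x, xC x, f₀) = (toPt f₀ x : PtR ι ρ ν κ) := by
    simp only [toPt, config_eq_a0 q.2.1]
  rw [e] at h
  exact h

/-- A cube point of the down-closure is realised in `Q` by its bottom point. -/
lemma botPt_mem_of_Mt (hL : ArmLower arm Q) (hR : RaiseUP arm Q) {f₀ : Config κ}
    {x : Config (ι ⊕ ρ)} (hx : x ∈ Mt Q arm f₀) : (botPt f₀ x : PtR ι ρ ν κ) ∈ Q := by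
  obtain ⟨q, hq, hqL, hs, hf, -⟩ := hx
  have h := mem_botPt_of_red hL hR hq hqL hs (xC x) (le_of_eq hf.symm)
  have e : ((fun _ => false), q.2.1, xC x, (fun _ => false), f₀) = (botPt f₀ x : PtR ι ρ ν κ) := by
    simp only [botPt, config_eq_a0 q.2.1]
  rw [e] at h
  exact h

/-- The realisation of a cube point in `Q`: the diagonal point at a mixed `s`, the bottom point at
`s = ⊥`. -/
noncomputable def realize (f₀ : Config κ) (x : Config (ι ⊕ ρ)) : PtR ι ρ ν κ :=
  if ∃ j, xs x j = true then toPt f₀ x else botPt f₀ x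

omit [Nonempty ι] in
/-- The cube projection of the realisation is the point. -/
lemma projCube_realize (f₀ : Config κ) (x : Config (ι ⊕ ρ)) :
    projCube (realize f₀ x : PtR ι ρ ν κ) = x := by
  unfold realize
  split_ifs with h
  · exact projCube_toPt f₀ x
  · exact projCube_botPt f₀ (fun j => by simpa using not_exists.1 h j)

/-- The realisation of a cube point of the down-closure with a blue u-arm is a non-leaking point
of `Q`. -/
lemma realize_mem (hL : ArmLower arm Q) (hR : RaiseUP arm Q) {f₀ : Config κ}
    {x : Config (ι ⊕ ρ)} (hx : x ∈ Mt Q arm f₀) (hs' : ∃ j, xs x j = false) :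
    (realize f₀ x : PtR ι ρ ν κ) ∈ Q ∧ ¬ Leak (realize f₀ x : PtR ι ρ ν κ) arm := by
  unfold realize
  split_ifs with h
  · exact ⟨toPt_mem_of_Mt hL hx hs', not_leak_of_uP_eq_e rfl⟩
  · exact ⟨botPt_mem_of_Mt hL hR hx,
      not_leak_of_bot_le (fun _ => rfl) (fun _ => Bool.false_le _)⟩

omit [Nonempty ι] in
/-- The `f`-frozen blue set of the realisation is the red set of the flipped cube point. -/
lemma EBT_realize [DecidableEq κ] (f₀ : Config κ) (x : Config (ι ⊕ ρ)) :
    EBT ∅ (realize f₀ x : PtR ι ρ ν κ) = ER (toPt f₀ (flipAll x) : PtR ι ρ ν κ) := by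
  unfold realize
  split_ifs with h
  · exact EBT_toPt f₀ x
  · exact EBT_botPt f₀ (fun j => by simpa using not_exists.1 h j)

omit [Nonempty ι] in
/-- The realisation is a mixed point with `uP = e`, or a B-slab point with `e = ⊥`. -/
lemma realize_kind (f₀ : Config κ) {x : Config (ι ⊕ ρ)} (hs' : ∃ j, xs x j = false) :
    ((∃ j, (realize f₀ x : PtR ι ρ ν κ).1 j = true) ∧
        (∃ j, (realize f₀ x : PtR ι ρ ν κ).1 j = false) ∧
        (realize f₀ x : PtR ι ρ ν κ).2.2.1 = (realize f₀ x : PtR ι ρ ν κ).2.2.2.1) ∨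
      ((∀ j, (realize f₀ x : PtR ι ρ ν κ).1 j = false) ∧
        (realize f₀ x : PtR ι ρ ν κ).2.2.2.1 = fun _ => false) := by
  unfold realize
  split_ifs with h
  · exact Or.inl ⟨h, hs', rfl⟩
  · exact Or.inr ⟨fun _ => rfl, rfl⟩

end LowerSet

end MixedArms

end Summit.Ventures.PercRepro2
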